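import Mathlib
import HarnessLib

/-!
# Generators of the principal congruence subgroup `Γ(2)`

`Γ(2) ≤ SL(2, ℤ)` is generated by `T² = (1 2; 0 1)`, `S T² S⁻¹ = (1 0; -2 1)` and `-1`
(equivalently `Γ(2) = {±1} × F` with `F` free on `T²` and `(1 0; 2 1)`; we prove only the
generation statement). This is the group-theoretic input for checking `Γ(2)`-invariance of a
function on `ℍ` on three matrices — e.g. for the modular `λ`-function, the Hauptmodul of `Γ(2)`
uniformizing `Y(2) ≅ ℙ¹ ∖ {0, 1, ∞}` that underlies Calegari–Dimitrov–Tang's proof of the unbounded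
denominators conjecture (F. Calegari, V. Dimitrov, Y. Tang, J. Amer. Math. Soc. **38** (2025),
arXiv:2109.09040, §1 p. 3: "`f` is then an algebraic function of `λ`, with branching only at the
three punctures `λ = 0, 1, ∞` of the modular curve `Y(2)`").

Proof: Euclidean descent. For `γ = (a b; c d) ∈ Γ(2)` (`a, d` odd, `b, c` even) with `c ≠ 0`,
left multiplication by `T^{-2k}` replaces `a` by `a − 2kc` with `|a − 2kc| < |c|` (a centred
remainder modulo `2|c|`, strict because `a − 2kc` is odd while `c` is even), then left
multiplication by `S T^{2l} S⁻¹ = (1 0; -2l 1)` replaces `c` by `c − 2l a'` with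
`|c − 2la'| < |a'|`; so `|c|` strictly decreases, and `c = 0` forces `γ = ± T^{b}` with `b` even
(cf. Mathlib's `SpecialLinearGroup.SL2Z_generators` for `SL(2, ℤ) = ⟨S, T⟩`).

## Contents (theorems only; no definitions, no named facts)

* `exists_abs_sub_two_mul_mul_lt` — the centred-remainder step.
* `Gamma_two_le_closure`, `Gamma_two_eq_closure` — `Γ(2) = ⟨T², S T² S⁻¹, -1⟩`.
* `forall_mem_Gamma_two_slash_eq` — a weight-`k` function invariant under (the images in
  `GL(2, ℝ)` of) `T²`, `S T² S⁻¹` and `-1` is invariant under `Γ(2)` (Mathlib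
  `slash_action_generators`).

## References

* F. Diamond, J. Shurman, *A first course in modular forms*, GTM 228 (2005), §1.2 and §1.5
  (congruence subgroups, `Γ(2)`); standard.
* [CalegariDimitrovTang2025] arXiv:2109.09040, §1 (p. 3), rôle of `Y(2)` and `λ`.
-/

noncomputable section

namespace Literature.NumberTheory.Automorphic

open scoped MatrixGroups ModularGroup ModularForm
open CongruenceSubgroup Matrix.SpecialLinearGroup ModularGroup UpperHalfPlane

namespace GammaTwo

/-! ### The centred remainder -/

/-- Centred remainder with a parity gap: if `c ≠ 0` and `a − c` is odd, some `a − 2kc` has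
absolute value `< |c|` (a remainder of `a` modulo `2|c|` lies in `(−|c|, |c|]`, and `= |c|` is
excluded by parity). [folklore] -/
theorem exists_abs_sub_two_mul_mul_lt {a c : ℤ} (hc : c ≠ 0) (hpar : ¬ (2 : ℤ) ∣ a - c) :
    ∃ k : ℤ, |a - 2 * k * c| < |c| := by
  have hc0 : 0 < |c| := abs_pos.mpr hc
  set m : ℤ := 2 * |c| with hm
  have hm0 : 0 < m := by positivity
  set r : ℤ := a % m with hr
  set q : ℤ := a / m with hq
  have hr0 : 0 ≤ r := Int.emod_nonneg a hm0.ne'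
  have hrm : r < m := Int.emod_lt_of_pos a hm0
  have hdiv : m * q + r = a := Int.mul_ediv_add_emod a m
  -- `|c| = sign c * c`
  have hsc : |c| = Int.sign c * c := by
    rcases hc.lt_or_gt with h | h
    · rw [abs_of_neg h, Int.sign_eq_neg_one_of_neg h]; ring
    · rw [abs_of_pos h, Int.sign_eq_one_of_pos h]; ring
  have key : ∀ t : ℤ, 2 * (t * Int.sign c) * c = m * t := by
    intro t
    rw [hm, hsc]; ring
  -- parity: `r ≠ |c|`
  have hrc : r ≠ |c| := by
    intro h
    apply hpar
    have h1 : (2 : ℤ) ∣ a - r := ⟨|c| * q, by linear_combination -hdiv⟩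
    have h2 : (2 : ℤ) ∣ |c| - c := by
      rcases abs_choice c with h' | h' <;> rw [h']
      · simp
      · exact ⟨-c, by ring⟩
    have := dvd_add h1 h2
    rwa [h, sub_add_sub_cancel] at this
  by_cases hlt : r < |c|
  · refine ⟨q * Int.sign c, ?_⟩
    have : a - 2 * (q * Int.sign c) * c = r := by rw [key]; linear_combination -hdiv
    rwa [this, abs_of_nonneg hr0]
  · refine ⟨(q + 1) * Int.sign c, ?_⟩
    have hcr : |c| < r := lt_of_le_of_ne (not_lt.mp hlt) (Ne.symm hrc)
    have : a - 2 * ((q + 1) * Int.sign c) * c = r - m := by rw [key]; linear_combination -hdiv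
    rw [this, abs_of_neg (by linarith), neg_sub, hm]
    linarith

/-! ### Matrix entries of the elementary moves -/

/-- `(Tᵐ γ)₀₀ = γ₀₀ + m γ₁₀` and `(Tᵐ γ)₁₀ = γ₁₀`. [folklore] -/
theorem T_zpow_mul_apply (m : ℤ) (γ : SL(2, ℤ)) :
    (T ^ m * γ) 0 0 = γ 0 0 + m * γ 1 0 ∧ (T ^ m * γ) 1 0 = γ 1 0 := by
  constructor <;>
    simp [Matrix.SpecialLinearGroup.coe_mul, ModularGroup.coe_T_zpow, Matrix.mul_apply,
      Fin.sum_univ_two]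

/-- `S Tᵐ S⁻¹ = (1 0; -m 1)`. [folklore] -/
theorem coe_S_mul_T_zpow_mul_S_inv (m : ℤ) :
    ((S * T ^ m * S⁻¹ : SL(2, ℤ)) : Matrix (Fin 2) (Fin 2) ℤ) = !![1, 0; -m, 1] := by
  rw [Matrix.SpecialLinearGroup.coe_mul, Matrix.SpecialLinearGroup.coe_mul,
    Matrix.SpecialLinearGroup.coe_inv, ModularGroup.coe_T_zpow, ModularGroup.coe_S,
    Matrix.adjugate_fin_two_of]
  ext i j
  fin_cases i <;> fin_cases j <;> simp

/-- `(S Tᵐ S⁻¹ γ)₀₀ = γ₀₀` and `(S Tᵐ S⁻¹ γ)₁₀ = γ₁₀ − m γ₀₀`. [folklore] -/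
theorem S_T_zpow_S_inv_mul_apply (m : ℤ) (γ : SL(2, ℤ)) :
    (S * T ^ m * S⁻¹ * γ) 0 0 = γ 0 0 ∧ (S * T ^ m * S⁻¹ * γ) 1 0 = γ 1 0 - m * γ 0 0 := by
  have h := coe_S_mul_T_zpow_mul_S_inv m
  constructor
  · rw [Matrix.SpecialLinearGroup.coe_mul, h]
    simp [Matrix.mul_apply, Fin.sum_univ_two]
  · rw [Matrix.SpecialLinearGroup.coe_mul, h]
    simp [Matrix.mul_apply, Fin.sum_univ_two]
    ring

/-! ### Generation of `Γ(2)` -/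

/-- **`Γ(2) ≤ ⟨T², S T² S⁻¹, -1⟩`** (Euclidean descent on `|γ₁₀|`). [folklore] -/
theorem Gamma_two_le_closure :
    Gamma 2 ≤ Subgroup.closure ({T ^ 2, S * T ^ 2 * S⁻¹, -1} : Set SL(2, ℤ)) := by
  set H := Subgroup.closure ({T ^ 2, S * T ^ 2 * S⁻¹, -1} : Set SL(2, ℤ)) with hH
  have hT2 : T ^ 2 ∈ H := Subgroup.subset_closure (by simp)
  have hU2 : S * T ^ 2 * S⁻¹ ∈ H := Subgroup.subset_closure (by simp)
  have hneg : (-1 : SL(2, ℤ)) ∈ H := Subgroup.subset_closure (by simp)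
  have hT : ∀ k : ℤ, T ^ (2 * k) ∈ H := fun k ↦ by
    rw [zpow_mul]
    exact H.zpow_mem (by exact_mod_cast hT2) k
  have hU : ∀ k : ℤ, S * T ^ (2 * k) * S⁻¹ ∈ H := fun k ↦ by
    have h := H.zpow_mem hU2 k
    rw [conj_zpow] at h
    convert h using 2
    rw [zpow_mul]
    norm_cast
  -- parity data of an element of `Γ(2)`
  have parity : ∀ γ : SL(2, ℤ), γ ∈ Gamma 2 → ¬ (2 : ℤ) ∣ γ 0 0 ∧ (2 : ℤ) ∣ γ 1 0 := by
    intro γ hγ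
    obtain ⟨h00, -, h10, -⟩ := Gamma_mem.mp hγ
    refine ⟨fun h2 ↦ ?_, by exact_mod_cast (ZMod.intCast_zmod_eq_zero_iff_dvd _ 2).mp h10⟩
    have h0 : ((γ 0 0 : ℤ) : ZMod 2) = 0 :=
      (ZMod.intCast_zmod_eq_zero_iff_dvd _ 2).mpr (by exact_mod_cast h2)
    rw [h0] at h00
    exact zero_ne_one h00
  -- descent on `|γ₁₀|`
  suffices key : ∀ n : ℕ, ∀ γ : SL(2, ℤ), γ ∈ Gamma 2 → (γ 1 0).natAbs ≤ n → γ ∈ H from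
    fun γ hγ ↦ key _ γ hγ le_rfl
  intro n
  induction n with
  | zero =>
    intro γ hγ hn
    have hc : γ 1 0 = 0 := Int.natAbs_eq_zero.mp (Nat.le_zero.mp hn)
    obtain ⟨-, h01, -, -⟩ := Gamma_mem.mp hγ
    obtain ⟨b, hb⟩ : (2 : ℤ) ∣ γ 0 1 := by
      exact_mod_cast (ZMod.intCast_zmod_eq_zero_iff_dvd _ 2).mp h01
    have hdet := γ.prop
    rw [Matrix.det_fin_two, hc, mul_zero, sub_zero] at hdet
    rcases Int.mul_eq_one_iff_eq_one_or_neg_one.mp hdet with ⟨ha, hd⟩ | ⟨ha, hd⟩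
    · -- `γ = T^b`, `b` even
      have : γ = T ^ (2 * b) := by
        ext i j
        rw [ModularGroup.coe_T_zpow]
        fin_cases i <;> fin_cases j <;> simp [ha, hb, hc, hd]
      rw [this]
      exact hT b
    · -- `γ = -T^{-b}`
      have : γ = -1 * T ^ (2 * (-b)) := by
        ext i j
        rw [neg_one_mul, Matrix.SpecialLinearGroup.coe_neg, ModularGroup.coe_T_zpow]
        fin_cases i <;> fin_cases j <;> simp [ha, hb, hc, hd]
      rw [this]
      exact H.mul_mem hneg (hT _)
  | succ n ih =>
    intro γ hγ hn
    rcases Nat.lt_or_ge (γ 1 0).natAbs (n + 1) with hlt | hge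
    · exact ih γ hγ (Nat.lt_succ_iff.mp hlt)
    -- now `|c| = n + 1 > 0`
    obtain ⟨ha2, hc2⟩ := parity γ hγ
    have hc0 : γ 1 0 ≠ 0 := by
      intro h0
      rw [h0, Int.natAbs_zero] at hge
      omega
    -- Step A: reduce `a` modulo `2c`
    have hparA : ¬ (2 : ℤ) ∣ γ 0 0 - γ 1 0 := fun h ↦ ha2 (by simpa using dvd_add h hc2)
    obtain ⟨k, hk⟩ := exists_abs_sub_two_mul_mul_lt hc0 hparA
    set γ₁ : SL(2, ℤ) := T ^ (2 * (-k)) * γ with hγ₁def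
    have hγ₁ : γ₁ ∈ Gamma 2 := by
      refine mul_mem ?_ hγ
      simpa using ModularGroup_T_pow_mem_Gamma 2 (2 * (-k)) (dvd_mul_right 2 (-k))
    obtain ⟨hγ₁00, hγ₁10⟩ := T_zpow_mul_apply (2 * (-k)) γ
    have ha₁ : γ₁ 0 0 = γ 0 0 - 2 * k * γ 1 0 := by rw [hγ₁00]; ring
    have ha₁lt : |γ₁ 0 0| < |γ 1 0| := by rw [ha₁]; exact hk
    obtain ⟨ha₁2, -⟩ := parity γ₁ hγ₁
    have ha₁0 : γ₁ 0 0 ≠ 0 := fun h0 ↦ ha₁2 (by rw [h0]; exact dvd_zero 2)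
    -- Step B: reduce `c` modulo `2a₁`
    have hparB : ¬ (2 : ℤ) ∣ γ₁ 1 0 - γ₁ 0 0 := by
      intro h
      rw [hγ₁10] at h
      exact ha₁2 (by simpa using dvd_sub hc2 h)
    obtain ⟨l, hl⟩ := exists_abs_sub_two_mul_mul_lt ha₁0 hparB
    set γ₂ : SL(2, ℤ) := S * T ^ (2 * l) * S⁻¹ * γ₁ with hγ₂def
    have hγ₂ : γ₂ ∈ Gamma 2 := by
      refine mul_mem ((Gamma_normal 2).conj_mem _ ?_ S) hγ₁
      simpa using ModularGroup_T_pow_mem_Gamma 2 (2 * l) (dvd_mul_right 2 l)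
    obtain ⟨-, hγ₂10⟩ := S_T_zpow_S_inv_mul_apply (2 * l) γ₁
    have hc₂ : γ₂ 1 0 = γ₁ 1 0 - 2 * l * γ₁ 0 0 := by rw [hγ₂10]
    have hc₂lt : (γ₂ 1 0).natAbs ≤ n := by
      have h1 : |γ₂ 1 0| < |γ₁ 0 0| := by rw [hc₂]; exact hl
      have h2 : |γ₂ 1 0| < |γ 1 0| := h1.trans ha₁lt
      have h3 : (γ₂ 1 0).natAbs < (γ 1 0).natAbs := by
        rw [Int.abs_eq_natAbs, Int.abs_eq_natAbs] at h2
        exact_mod_cast h2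
      omega
    have hγ₂H : γ₂ ∈ H := ih γ₂ hγ₂ hc₂lt
    -- undo the two moves
    have hγ₁H : γ₁ ∈ H := by
      have : γ₁ = (S * T ^ (2 * l) * S⁻¹)⁻¹ * γ₂ := by rw [hγ₂def, inv_mul_cancel_left]
      rw [this]
      exact H.mul_mem (H.inv_mem (hU l)) hγ₂H
    have : γ = (T ^ (2 * (-k)))⁻¹ * γ₁ := by rw [hγ₁def, inv_mul_cancel_left]
    rw [this]
    exact H.mul_mem (H.inv_mem (hT _)) hγ₁H

/-- **`Γ(2) = ⟨T², S T² S⁻¹, -1⟩`**: the principal congruence subgroup of level `2` is generated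
by `T² = (1 2; 0 1)`, `S T² S⁻¹ = (1 0; -2 1)` and `-1`. [folklore] -/
theorem Gamma_two_eq_closure :
    Gamma 2 = Subgroup.closure ({T ^ 2, S * T ^ 2 * S⁻¹, -1} : Set SL(2, ℤ)) := by
  refine le_antisymm Gamma_two_le_closure ((Subgroup.closure_le _).mpr ?_)
  have hT2 : T ^ 2 ∈ Gamma 2 := by
    have h : T ^ (2 : ℤ) ∈ Gamma 2 := ModularGroup_T_pow_mem_Gamma 2 2 dvd_rfl
    rwa [zpow_ofNat] at h
  rintro x (rfl | rfl | rfl)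
  · exact hT2
  · exact (Gamma_normal 2).conj_mem _ hT2 S
  · rw [SetLike.mem_coe, Gamma_mem]
    refine ⟨?_, ?_, ?_, ?_⟩ <;> simp

/-- **Invariance under `Γ(2)` from three matrices.** A function `f : ℍ → ℂ` which is weight-`k`
invariant under (the images in `GL(2, ℝ)` of) `T²`, `S T² S⁻¹` and `-1` is weight-`k` invariant
under all of `Γ(2)` (Mathlib `slash_action_generators` with `Gamma_two_eq_closure`). [folklore] -/
theorem forall_mem_Gamma_two_slash_eq {f : ℍ → ℂ} {k : ℤ}
    (hT : f ∣[k] (mapGL ℝ (T ^ 2) : GL (Fin 2) ℝ) = f)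
    (hU : f ∣[k] (mapGL ℝ (S * T ^ 2 * S⁻¹) : GL (Fin 2) ℝ) = f)
    (hE : f ∣[k] (mapGL ℝ (-1 : SL(2, ℤ)) : GL (Fin 2) ℝ) = f) :
    ∀ γ ∈ Gamma 2, f ∣[k] (mapGL ℝ γ : GL (Fin 2) ℝ) = f := by
  have hΓ : ((Gamma 2 : Subgroup SL(2, ℤ)) : Subgroup (GL (Fin 2) ℝ)) =
      Subgroup.closure ((mapGL ℝ : SL(2, ℤ) →* GL (Fin 2) ℝ) ''
        ({T ^ 2, S * T ^ 2 * S⁻¹, -1} : Set SL(2, ℤ))) := by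
    change (Gamma 2).map (mapGL ℝ) = _
    rw [Gamma_two_eq_closure, MonoidHom.map_closure]
  have hall := (SlashInvariantForm.slash_action_generators hΓ (f := f) (k := k)).mpr (by
    rintro _ ⟨x, hx, rfl⟩
    rcases hx with rfl | rfl | rfl
    · exact hT
    · exact hU
    · exact hE)
  intro γ hγ
  exact hall _ (Subgroup.mem_map_of_mem _ hγ)

end GammaTwo

end Literature.NumberTheory.Automorphic

end
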